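import Literature.Analysis.FluidPDE.KatoLaiSymForm
import Mathlib.MeasureTheory.Integral.IntervalIntegral.FundThmCalculus
import Mathlib.Analysis.Calculus.MeanValue
import HarnessLib

/-!
# Kato–Lai in the periodic cylinder: calculus of the solution in duality form

Analysis/FluidPDE support file for the energy-method construction of Euler flows in the
periodic cylinder (`Literature.Analysis.FluidPDE.KatoLai1984_periodicCylinderUniformExistence`;
Kato–Lai 1984, §3 (3.3) `u ∈ C_w(I; H) ∩ C¹_w(I; X)` and §5, p. 22: "`u(t) ∈ H⁰` is strongly
continuous in `t` by `dₜu ∈ C_w(I_T, H⁰)`"). For a solution in duality form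
`u : [0, T] → SymL2` of `KatoLaiSymForm.exists_formSolution_klForm` at the weight `klWeight s ε`:

* `inner_embed_left` — `i = diag w⁻¹` is symmetric;
* `continuousOn_klOpExt_sol` — **`t ↦ 𝒜̂ u(t)` is norm continuous** on `[0, T]` (weak continuity
  and boundedness of `u`, and (E3) of `KatoLaiSymOperator`);
* `klVel u t = i (u t)` — the `L²`-level coefficient family of the velocity; for every `v`,
  `dₜ ⟪v, klVel u t⟫ = −⟪𝒜̂ u(t), v⟫`, whence **the strong form**
  `klVel u t − klVel u 0 = −∫₀ᵗ 𝒜̂ u(τ) dτ` (`klVel_sub_eq_integral`) and the strong derivative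
  (`hasDerivWithinAt_klVel`), with the Lipschitz bound `‖klVel u t − klVel u t'‖ ≤ C |t − t'|`.

Everything is proved; no named fact and no `sorry` is introduced.

## References

* T. Kato, C. Y. Lai, J. Funct. Anal. 56 (1984) 15–28, §3, §5. [KatoLai1984]
-/

noncomputable section

open MeasureTheory Set Function Filter Topology TopologicalSpace
open scoped NNReal ENNReal InnerProductSpace RealInnerProductSpace

namespace Literature.Analysis.FluidPDE

open FunctionSpaces FunctionSpaces.Torus UnitAddTorus

namespace PeriodicCylinder

variable {L : ℝ} (hL : 0 < L) (s : ℕ) (ε : ℝ)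

/-! ### Symmetry of the inclusion -/

/-- `⟪i v, f⟫ = ⟪v, i f⟫`: the inclusion is a real diagonal multiplier. [folklore] -/
theorem inner_embed_left (v f : SymL2 (Fin 3)) : ⟪embed s ε v, f⟫_ℝ = ⟪v, embed s ε f⟫_ℝ := by
  refine (SymL2.hasSum_inner (embed s ε v) f).unique ((SymL2.hasSum_inner v (embed s ε f)).congr_fun fun k => ?_)
  rw [embed_apply, embed_apply, inner_smul_left, inner_smul_right, map_inv₀, Complex.conj_ofReal]

/-! ### Norm continuity of `𝒜̂ u(t)` -/

section Sol

variable {φ : SymL2 (Fin 3)} {T : ℝ} {u : ℝ → SymL2 (Fin 3)}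

/-- Weak continuity along sequences within `[0, T]`. [folklore] -/
theorem weakTendsto_sol (hu : KatoLai.IsFormSolution (embed s ε) (klForm hL s ε) φ T u) {t : ℕ → ℝ} {t' : ℝ}
    (ht : ∀ n, t n ∈ Icc 0 T) (ht' : t' ∈ Icc 0 T) (htt : Tendsto t atTop (𝓝 t')) :
    SymL2.WeakTendsto (fun n => u (t n)) (u t') := fun h => by
  have hc := (hu.continuousOn_inner h) t' ht'
  have : Tendsto t atTop (𝓝[Icc 0 T] t') := tendsto_nhdsWithin_iff.2 ⟨htt, Eventually.of_forall ht⟩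
  exact hc.tendsto.comp this

/-- **`t ↦ 𝒜̂ u(t)` is norm continuous on `[0, T]`.** [cite: KatoLai1984, §5 (p. 22)] -/
theorem continuousOn_klOpExt_sol (hu : KatoLai.IsFormSolution (embed s ε) (klForm hL s ε) φ T u) :
    ContinuousOn (fun t => klOpExt hL s ε (u t)) (Icc 0 T) := by
  intro t' ht'
  rw [ContinuousWithinAt, tendsto_iff_seq_tendsto]
  intro t ht
  rw [tendsto_nhdsWithin_iff] at ht
  obtain ⟨htt, hmem⟩ := ht
  -- along the sequence, eventually in `Icc`; modify the finitely many exceptions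
  have hev : ∀ᶠ n in atTop, t n ∈ Icc 0 T := hmem
  obtain ⟨N, hN⟩ := eventually_atTop.1 hev
  -- shifted sequence
  have hshift : SymL2.WeakTendsto (fun n => u (t (n + N))) (u t') :=
    weakTendsto_sol hL s ε hu (fun n => hN _ (Nat.le_add_left N n)) ht' (htt.comp (tendsto_add_atTop_nat N))
  have h := tendsto_klOpExt_of_weakTendsto hL s ε hshift
  exact (tendsto_add_atTop_iff_nat N).1 h

/-- The operator along the solution is bounded on `[0, T]`. [folklore] -/
theorem exists_norm_klOpExt_sol_le (hu : KatoLai.IsFormSolution (embed s ε) (klForm hL s ε) φ T u) :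
    ∃ R : ℝ, 0 ≤ R ∧ ∀ t ∈ Icc 0 T, ‖klOpExt hL s ε (u t)‖ ≤ R := by
  obtain ⟨R, hR⟩ := (isCompact_Icc (a := (0 : ℝ)) (b := T)).exists_bound_of_continuousOn (continuousOn_klOpExt_sol hL s ε hu)
  exact ⟨max R 0, le_max_right _ _, fun t ht => (hR t ht).trans (le_max_left _ _)⟩

/-! ### The velocity coefficients and the strong equation -/

/-- **The `L²`-level coefficient family of the velocity**: `i (u t)` (stores `û(t, k)`). [folklore] -/
def klVel (u : ℝ → SymL2 (Fin 3)) (t : ℝ) : SymL2 (Fin 3) := embed s ε (u t)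

/-- The weak equation for `klVel`: `dₜ ⟪v, klVel u t⟫ = −⟪𝒜̂ u(t), v⟫` within `[0, T]`. [cite: KatoLai1984, §3 (A)] -/
theorem hasDerivWithinAt_inner_klVel (hu : KatoLai.IsFormSolution (embed s ε) (klForm hL s ε) φ T u) (v : SymL2 (Fin 3))
    {t : ℝ} (ht : t ∈ Icc 0 T) :
    HasDerivWithinAt (fun τ => ⟪v, klVel s ε u τ⟫_ℝ) (-⟪klOpExt hL s ε (u t), v⟫_ℝ) (Icc 0 T) t := by
  have h := hu.hasDerivWithinAt v t ht
  simp only [klForm_apply] at h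
  refine h.congr (fun τ _ => ?_) ?_
  · exact (inner_embed_left s ε v (u τ)).symm
  · exact (inner_embed_left s ε v (u t)).symm

/-- The continuous extension of `τ ↦ 𝒜̂ u(τ)` from `[0, T]` to `ℝ` (constant outside). [folklore] -/
def klOpPath (hL : 0 < L) (s : ℕ) (ε : ℝ) (T : ℝ) (u : ℝ → SymL2 (Fin 3)) (τ : ℝ) : SymL2 (Fin 3) :=
  klOpExt hL s ε (u (max 0 (min τ T)))

/-- On `[0, T]` the path is `𝒜̂ u(τ)`. [folklore] -/
theorem klOpPath_of_mem {τ : ℝ} (hτ : τ ∈ Icc 0 T) : klOpPath hL s ε T u τ = klOpExt hL s ε (u τ) := by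
  rw [klOpPath, min_eq_left hτ.2, max_eq_right hτ.1]

/-- The path is continuous on `ℝ`. [folklore] -/
theorem continuous_klOpPath (hu : KatoLai.IsFormSolution (embed s ε) (klForm hL s ε) φ T u) (hT : 0 ≤ T) :
    Continuous (klOpPath hL s ε T u) := by
  have hc := continuousOn_klOpExt_sol hL s ε hu
  have hproj : Continuous fun τ : ℝ => max 0 (min τ T) := continuous_const.max (continuous_id.min continuous_const)
  have hmem : ∀ τ : ℝ, max 0 (min τ T) ∈ Icc 0 T := fun τ => ⟨le_max_left _ _, max_le hT (min_le_right _ _)⟩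
  exact hc.comp_continuous hproj hmem

/-- **The strong form of the equation**: `klVel u t − klVel u 0 = −∫₀ᵗ 𝒜̂ u(τ) dτ` for `t ∈ [0, T]`.
[cite: KatoLai1984, §5 (p. 22)] -/
theorem klVel_sub_eq_integral (hu : KatoLai.IsFormSolution (embed s ε) (klForm hL s ε) φ T u) (hT : 0 ≤ T)
    {t : ℝ} (ht : t ∈ Icc 0 T) :
    klVel s ε u t - klVel s ε u 0 = -∫ τ in (0 : ℝ)..t, klOpPath hL s ε T u τ := by
  have hcont := continuous_klOpPath hL s ε hu hT
  -- test against every `v`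
  have key : ∀ v : SymL2 (Fin 3), ⟪v, klVel s ε u t - klVel s ε u 0 + ∫ τ in (0 : ℝ)..t, klOpPath hL s ε T u τ⟫_ℝ = 0 := by
    intro v
    set F : ℝ → ℝ := fun τ => ⟪v, klVel s ε u τ⟫_ℝ + ∫ σ in (0 : ℝ)..τ, ⟪v, klOpPath hL s ε T u σ⟫_ℝ with hF
    have hFc : ContinuousOn F (Icc 0 T) := by
      refine ContinuousOn.add ?_ ?_
      · have := hu.continuousOn_inner v
        refine (hu.continuousOn_inner (embed s ε v)).congr fun τ _ => ?_
        exact (inner_embed_left s ε v (u τ)).symm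
      · exact (intervalIntegral.continuous_primitive (fun a b => (hcont.inner continuous_const |>.congr fun σ =>
          real_inner_comm _ _).intervalIntegrable a b) 0).continuousOn
    have hFd : ∀ x ∈ Ico 0 T, HasDerivWithinAt F 0 (Ici x) x := by
      intro x hx
      have hxI : x ∈ Icc 0 T := ⟨hx.1, hx.2.le⟩
      have h1 := hasDerivWithinAt_inner_klVel hL s ε hu v hxI
      have h2 : HasDerivAt (fun τ => ∫ σ in (0 : ℝ)..τ, ⟪v, klOpPath hL s ε T u σ⟫_ℝ) ⟪v, klOpPath hL s ε T u x⟫_ℝ x := by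
        have hci : Continuous fun σ => ⟪v, klOpPath hL s ε T u σ⟫_ℝ := continuous_const.inner hcont
        exact intervalIntegral.integral_hasDerivAt_right (hci.intervalIntegrable 0 x) hci.aestronglyMeasurable.stronglyMeasurableAtFilter
          hci.continuousAt
      have h3 : HasDerivWithinAt F (-⟪klOpExt hL s ε (u x), v⟫_ℝ + ⟪v, klOpPath hL s ε T u x⟫_ℝ) (Icc 0 T) x :=
        h1.add h2.hasDerivWithinAt
      rw [klOpPath_of_mem hL s ε hxI, real_inner_comm, neg_add_cancel] at h3
      have hmem : Icc 0 T ∈ 𝓝[Ici x] x := mem_of_superset (Icc_mem_nhdsGE hx.2) (Icc_subset_Icc hx.1 le_rfl)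
      exact h3.mono_of_mem_nhdsWithin hmem
    have hconst := constant_of_has_deriv_right_zero hFc hFd t ht
    simp only [hF, intervalIntegral.integral_same, add_zero] at hconst
    have hint : ∫ σ in (0 : ℝ)..t, ⟪v, klOpPath hL s ε T u σ⟫_ℝ = ⟪v, ∫ σ in (0 : ℝ)..t, klOpPath hL s ε T u σ⟫_ℝ := by
      simp only [intervalIntegral.integral_of_le ht.1]
      exact integral_inner ((hcont.integrableOn_Icc).mono_set Ioc_subset_Icc_self) v
    rw [inner_add_right, inner_sub_right, ← hint]
    linarith
  have h0 : klVel s ε u t - klVel s ε u 0 + ∫ τ in (0 : ℝ)..t, klOpPath hL s ε T u τ = 0 := by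
    have := key (klVel s ε u t - klVel s ε u 0 + ∫ τ in (0 : ℝ)..t, klOpPath hL s ε T u τ)
    exact inner_self_eq_zero.1 this
  exact eq_neg_of_add_eq_zero_left h0

/-- **The strong derivative**: `dₜ klVel u t = −𝒜̂ u(t)` within `[0, T]`. [cite: KatoLai1984, §5 (p. 22)] -/
theorem hasDerivWithinAt_klVel (hu : KatoLai.IsFormSolution (embed s ε) (klForm hL s ε) φ T u) (hT : 0 ≤ T)
    {t : ℝ} (ht : t ∈ Icc 0 T) :
    HasDerivWithinAt (klVel s ε u) (-klOpExt hL s ε (u t)) (Icc 0 T) t := by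
  have hcont := continuous_klOpPath hL s ε hu hT
  have hprim : HasDerivAt (fun τ => ∫ σ in (0 : ℝ)..τ, klOpPath hL s ε T u σ) (klOpPath hL s ε T u t) t :=
    intervalIntegral.integral_hasDerivAt_right (hcont.intervalIntegrable 0 t) hcont.aestronglyMeasurable.stronglyMeasurableAtFilter
      hcont.continuousAt
  have h1 : HasDerivWithinAt (fun τ => klVel s ε u 0 - ∫ σ in (0 : ℝ)..τ, klOpPath hL s ε T u σ) (-klOpPath hL s ε T u t) (Icc 0 T) t := by
    have := (hprim.hasDerivWithinAt (s := Icc 0 T)).neg.const_add (klVel s ε u 0)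
    simpa [sub_eq_add_neg] using this
  rw [klOpPath_of_mem hL s ε ht] at h1
  refine h1.congr (fun τ hτ => ?_) ?_
  · have := klVel_sub_eq_integral hL s ε hu hT hτ
    rw [sub_eq_iff_eq_add] at this; rw [this]; abel
  · have := klVel_sub_eq_integral hL s ε hu hT ht
    rw [sub_eq_iff_eq_add] at this; rw [this]; abel

/-- **Lipschitz bound in time at the `L²` level**: `‖klVel u t − klVel u t'‖ ≤ R |t − t'|`.
[cite: KatoLai1984, §5 (p. 23: `u ∈ Lip(I_T; H⁰)`)] -/
theorem exists_norm_klVel_sub_le (hu : KatoLai.IsFormSolution (embed s ε) (klForm hL s ε) φ T u) (hT : 0 ≤ T) :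
    ∃ R : ℝ, 0 ≤ R ∧ ∀ t ∈ Icc 0 T, ∀ t' ∈ Icc 0 T, ‖klVel s ε u t - klVel s ε u t'‖ ≤ R * |t - t'| := by
  obtain ⟨R, hR0, hR⟩ := exists_norm_klOpExt_sol_le hL s ε hu
  refine ⟨R, hR0, fun t ht t' ht' => ?_⟩
  have hcont := continuous_klOpPath hL s ε hu hT
  have e : klVel s ε u t - klVel s ε u t' = -∫ τ in t'..t, klOpPath hL s ε T u τ := by
    have h1 := klVel_sub_eq_integral hL s ε hu hT ht
    have h2 := klVel_sub_eq_integral hL s ε hu hT ht'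
    have h3 : ∫ τ in t'..t, klOpPath hL s ε T u τ = (∫ τ in (0 : ℝ)..t, klOpPath hL s ε T u τ) - ∫ τ in (0 : ℝ)..t', klOpPath hL s ε T u τ :=
      (intervalIntegral.integral_interval_sub_left (hcont.intervalIntegrable 0 t) (hcont.intervalIntegrable 0 t')).symm
    rw [h3]
    have : klVel s ε u t - klVel s ε u t' = (klVel s ε u t - klVel s ε u 0) - (klVel s ε u t' - klVel s ε u 0) := by abel
    rw [this, h1, h2]; abel
  rw [e, norm_neg]
  refine intervalIntegral.norm_integral_le_of_norm_le_const (C := R) fun τ hτ => ?_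
  -- `τ ∈ Ι t' t ⊆ Icc 0 T`
  have hτI : τ ∈ Icc 0 T := by
    rcases le_total t' t with h | h
    · rw [uIoc_of_le h] at hτ; exact ⟨ht'.1.trans hτ.1.le, hτ.2.trans ht.2⟩
    · rw [uIoc_of_ge h] at hτ; exact ⟨ht.1.trans hτ.1.le, hτ.2.trans ht'.2⟩
  rw [klOpPath_of_mem hL s ε hτI]
  exact hR τ hτI

end Sol

end PeriodicCylinder

end Literature.Analysis.FluidPDE
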